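import Summits.ABC.ABC.Theorems.RibetTakahashiSplitAbcValuationProductFreyClass
import Summits.ABC.ABC.Theorems.RibetTakahashiSplitAbcValuationProductTwoPrimes

/-!
# `AbcValuationProduct`: the few-prime crux on the Frey class is the milestone on `ω(abc) ≤ 4`

Companion of `RibetTakahashiSplitAbcValuationProductFreyClass.lean` (which proves
`AbcValuationProduct ⟺ r2F ∧ r4F`, where r4F is the few-prime crux `FewPrimeValuationProduct` of
route ABC/RibetTakahashiSplit, stmt-ABC-1563, RESTRICTED to curves `ℚ`-isomorphic to a twisted
Frey–Hellegouarch curve `freyCurve (d a) (d b)`, `a, b` coprime, `ab(a+b) ≠ 0`, `d ∣ 2`). Here the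
few-prime factor is identified with a statement about abc triples alone:

* `AbcValuationProduct.freyClass_pointwise` — the pointwise dictionary for ONE curve `W` of the class
  (`n = |ab(a+b)|`): `T(W) ≤ 12^{ω(N)} ∏_{p ∣ n} ν_p(n)`, `rad(n) ≤ 2N`, and every odd prime of `n` is
  an odd multiplicative prime of `W` (the steps of `AbcValuationProduct.freyClass_valuationProduct_le`,
  isolated so that regime information can be threaded through);
* `AbcValuationProduct.fewPrimeFrey_of_fewPrimes` — `[∏ ν_p(abc) ≪_ε rad^ε on ω(abc) ≤ 4] ⟹ r4F`:
  a class curve with `≤ 3` odd multiplicative primes has `ω(n) ≤ 4`, and the rearranged abc triple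
  of `(a, b, a+b)` has product `n`;
* `AbcValuationProduct.fewPrimes_of_fewPrimeFrey` — `r4F ⟹ [∏ ν_p(abc) ≪_ε rad^ε on ω(abc) ≤ 4]`
  (glue B on the Frey curve of the triple, `N ∣ 2¹⁰ rad`, `∏ ν_p ≤ 4T`);
* `fewPrimeFrey_iff_fewPrimes` — hence **r4F ⟺ the milestone restricted to `ω(abc) ≤ 4`**, and with
  the two-prime theorem (Mihăilescu, `AbcValuationProduct.of_card_primeFactors_le_two`)
  `fewPrimeFrey_iff_threeFour` — **r4F ⟺ the milestone on `ω(abc) ∈ {3, 4}`**: the few-prime crux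
  re-cut to the Frey class is a statement about the coprime `S`-unit equations `a + b = c` with
  `|S| ≤ 4`, `2 ∈ S` (Pillai type), with no elliptic curve left in it. Combined with
  `AbcValuationProduct.bddOmega_iff_subexp` (sibling file `…AbcValuationProductSubexp`) it is
  sub-exponential abc `log c ≪_ε rad^ε` for those equations.

References: H. Pasten, *Shimura curves and the abc conjecture*, J. Number Theory 254 (2024)
= arXiv:1705.09251, Conj. 1.14; E. Bombieri, W. Gubler, *Heights in Diophantine Geometry* (2006),
Ex. 12.5.10.
-/

-- `Summit.<Summit>.<Problem>` is the mandated summit-side namespace (CONVENTIONS §2); for the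
-- single-conjunct summit `ABC` the two coincide, so the duplicate `ABC.ABC` is deliberate.
set_option linter.dupNamespace false

noncomputable section

namespace Summit.ABC.ABC.Theorems

open WeierstrassCurve UniqueFactorizationMonoid
open Literature.NumberTheory.EllipticCurves Literature.NumberTheory.DiophantineGeometry
open Summit.ABC.ABC.Theses.RibetTakahashiSplit

/-! ### The pointwise dictionary on the Frey–Hellegouarch class -/

-- adapted from Summits/ABC/ABC/Theorems/RibetTakahashiSplitAbcValuationProductFreyClass.lean
-- (`AbcValuationProduct.freyClass_valuationProduct_le`, steps (1), (2), (4)), curve by curve.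
/-- **Pointwise dictionary.** Let `W/ℚ` be elliptic with `C' • W = freyCurve (d a) (d b)` (`a, b`
coprime, `ab(a+b) ≠ 0`, `d ∣ 2`) and `n = |ab(a+b)|`. Then
(i) `T(W) = ∏_{p ∣ N, p² ∤ N} ord_p(Δ_min) ≤ 12^{ω(N)} · ∏_{p ∣ n} ν_p(n)` (at every prime
`ord_q(Δ_min) ≤ 4 + 2 ν_q(d³ n) ≤ 12 max(1, ν_q(n))`); (ii) `rad(n) ≤ 2N`; (iii) every odd prime of `n`
is a multiplicative prime of `W` (`f_p = 1` for odd `p ∣ ab(a+b)`,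
`factorization_conductorNorm_freyCurve_twist`). `[folklore]` -/
theorem AbcValuationProduct.freyClass_pointwise {W : WeierstrassCurve ℚ} [W.IsElliptic]
    {a b d : ℤ} {C' : VariableChange ℚ} (hab : IsCoprime a b) (h0 : a * b * (a + b) ≠ 0)
    (hd : d ∣ 2) (hW : C' • W = freyCurve (d * a) (d * b)) :
    multiplicativeValuationProduct W ≤
        12 ^ (W.conductorNorm ℤ).primeFactors.card * exponentProduct (a * b * (a + b)).natAbs ∧
      radical (a * b * (a + b)).natAbs ≤ 2 * W.conductorNorm ℤ ∧
      (a * b * (a + b)).natAbs.primeFactors.erase 2 ⊆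
        (W.conductorNorm ℤ).primeFactors.filter (fun p => p ≠ 2 ∧ ¬ p ^ 2 ∣ W.conductorNorm ℤ) := by
  have hd0 : d ≠ 0 := by rintro rfl; simp at hd
  have h0' : d * a * (d * b) * (d * a + d * b) ≠ 0 := by
    rw [show d * a * (d * b) * (d * a + d * b) = (d * d * d) * (a * b * (a + b)) by ring]
    exact mul_ne_zero (by simp [hd0]) h0
  rw [multiplicativeValuationProduct_def, exponentProduct_def,
    ManyPrimeValuationProduct.conductorNorm_eq_of_smul_eq hW,
    ManyPrimeValuationProduct.minimalDiscriminantNorm_eq_of_smul_eq hW]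
  haveI hE := isElliptic_freyCurve h0'
  set N : ℕ := (freyCurve (d * a) (d * b)).conductorNorm ℤ with hNdef
  set D : ℕ := (freyCurve (d * a) (d * b)).minimalDiscriminantNorm ℤ with hDdef
  set n : ℕ := (a * b * (a + b)).natAbs with hn
  have hn0 : n ≠ 0 := Int.natAbs_ne_zero.mpr h0
  have hNpos : 0 < N := conductorNorm_pos_holds _
  set S : Finset ℕ := N.primeFactors.filter (fun p => ¬ p ^ 2 ∣ N) with hS
  have hSN : S ⊆ N.primeFactors := Finset.filter_subset _ _
  -- (i a) per-prime bound `ord_q(Δ_min) ≤ 12 max(1, v_q(n))`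
  have hq : ∀ q ∈ S, D.factorization q ≤ 12 * max 1 (n.factorization q) := by
    intro q hqS
    have hqP : q.Prime := Nat.prime_of_mem_primeFactors (hSN hqS)
    have h1 := factorization_minimalDiscriminantNorm_freyCurve_le_add h0' hqP
    have h2 : (d * a * (d * b) * (d * a + d * b)).natAbs.factorization q ≤
        3 + n.factorization q := by
      rw [show d * a * (d * b) * (d * a + d * b) = (d * d * d) * (a * b * (a + b)) by ring,
        Int.natAbs_mul, Nat.factorization_mul (by simp [hd0]) hn0, Finsupp.add_apply]
      refine Nat.add_le_add_right ?_ _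
      have h8 : (d * d * d).natAbs ∣ 2 ^ 3 := by
        have h := Int.natAbs_dvd_natAbs.mpr (mul_dvd_mul (mul_dvd_mul hd hd) hd)
        simpa using h
      calc (d * d * d).natAbs.factorization q ≤ (2 ^ 3).factorization q :=
            (Nat.factorization_le_iff_dvd (by simp [hd0]) (by norm_num)).mpr h8 q
        _ ≤ 3 := by
            rw [Nat.factorization_pow, Finsupp.smul_apply, smul_eq_mul,
              Nat.prime_two.factorization, Finsupp.single_apply]
            split_ifs <;> omega
    have h3 : 1 ≤ max 1 (n.factorization q) := le_max_left _ _
    have h4 : n.factorization q ≤ max 1 (n.factorization q) := le_max_right _ _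
    rw [← hDdef] at h1
    omega
  -- (i b) the product bound `T ≤ 12^ω(N) · ∏_{p ∣ n} v_p(n)`
  have hT : ∏ q ∈ S, D.factorization q ≤
      12 ^ N.primeFactors.card * ∏ p ∈ n.primeFactors, n.factorization p := by
    have h1 : ∏ q ∈ S, D.factorization q ≤ ∏ q ∈ S, 12 * max 1 (n.factorization q) :=
      Finset.prod_le_prod (fun _ _ => Nat.zero_le _) hq
    have h2 : ∏ q ∈ S, max 1 (n.factorization q) ≤
        ∏ q ∈ S ∪ n.primeFactors, max 1 (n.factorization q) :=
      Finset.prod_le_prod_of_subset_of_one_le' Finset.subset_union_left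
        fun _ _ _ => le_max_left _ _
    have h3 : ∏ q ∈ n.primeFactors, max 1 (n.factorization q) =
        ∏ q ∈ S ∪ n.primeFactors, max 1 (n.factorization q) := by
      refine Finset.prod_subset Finset.subset_union_right fun q _ hqn => ?_
      have h : n.factorization q = 0 :=
        Finsupp.notMem_support_iff.mp (by rwa [Nat.support_factorization])
      rw [h, max_eq_left (Nat.zero_le 1)]
    have h4 : ∏ q ∈ n.primeFactors, max 1 (n.factorization q) =
        ∏ q ∈ n.primeFactors, n.factorization q :=
      Finset.prod_congr rfl fun q hqn => max_eq_right
        (Nat.Prime.factorization_pos_of_dvd (Nat.prime_of_mem_primeFactors hqn) hn0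
          (Nat.dvd_of_mem_primeFactors hqn))
    have h5 : 12 ^ S.card ≤ 12 ^ N.primeFactors.card :=
      Nat.pow_le_pow_right (by norm_num) (Finset.card_le_card hSN)
    calc ∏ q ∈ S, D.factorization q
        ≤ ∏ q ∈ S, 12 * max 1 (n.factorization q) := h1
      _ = 12 ^ S.card * ∏ q ∈ S, max 1 (n.factorization q) := by
          rw [Finset.prod_mul_distrib, Finset.prod_const]
      _ ≤ 12 ^ N.primeFactors.card * ∏ q ∈ n.primeFactors, n.factorization q := by
          rw [← h4, h3]; exact Nat.mul_le_mul h5 h2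
  -- (iii) every odd prime of `n` is a multiplicative prime of the twisted curve
  have hmult : n.primeFactors.erase 2 ⊆ N.primeFactors.filter (fun p => p ≠ 2 ∧ ¬ p ^ 2 ∣ N) := by
    intro p hp
    rw [Finset.mem_erase] at hp
    obtain ⟨hp2, hp⟩ := hp
    have hpP : p.Prime := Nat.prime_of_mem_primeFactors hp
    have hpn : (p : ℤ) ∣ a * b * (a + b) := Int.natCast_dvd.mpr (Nat.dvd_of_mem_primeFactors hp)
    have hf := ManyPrimeValuationProduct.factorization_conductorNorm_freyCurve_twist hab h0 hd hpP hp2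
    rw [if_pos hpn, ← hNdef] at hf
    rw [Finset.mem_filter]
    refine ⟨?_, hp2, fun h2 => ?_⟩
    · rw [← Nat.support_factorization, Finsupp.mem_support_iff, hf]
      exact one_ne_zero
    · have := (hpP.pow_dvd_iff_le_factorization hNpos.ne').mp h2
      omega
  -- (ii) `rad(n) ≤ 2N`
  have hsub : n.primeFactors ⊆ insert 2 N.primeFactors := by
    intro p hp
    rw [Finset.mem_insert]
    by_cases hp2 : p = 2
    · exact Or.inl hp2
    · exact Or.inr (Finset.mem_filter.mp (hmult (Finset.mem_erase.mpr ⟨hp2, hp⟩))).1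
  have hradn : radical n ≤ 2 * N := by
    rw [Nat.radical_eq_prod_primeFactors]
    calc ∏ p ∈ n.primeFactors, p ≤ ∏ p ∈ insert 2 N.primeFactors, p :=
          Finset.prod_le_prod_of_subset_of_one_le' hsub fun p hp _ => by
            rcases Finset.mem_insert.mp hp with rfl | hp
            · norm_num
            · exact (Nat.prime_of_mem_primeFactors hp).one_le
      _ ≤ 2 * ∏ p ∈ N.primeFactors, p := by
          by_cases h2N : 2 ∈ N.primeFactors
          · rw [Finset.insert_eq_of_mem h2N]
            exact Nat.le_mul_of_pos_left _ two_pos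
          · rw [Finset.prod_insert h2N]
      _ ≤ 2 * N := Nat.mul_le_mul_left 2 (Nat.le_of_dvd hNpos (Nat.prod_primeFactors_dvd N))
  exact ⟨hT, hradn, hmult⟩

/-! ### The milestone on `ω(abc) ≤ 4` gives r4F -/

-- adapted from Summits/ABC/ABC/Theorems/RibetTakahashiSplitAbcValuationProductFreyClass.lean
-- (`AbcValuationProduct.freyClass_valuationProduct_le`, steps (3), (5), (6)), with `ω(n) ≤ 4`.
/-- **`[∏ ν_p(abc) ≪_ε rad^ε on ω(abc) ≤ 4]` ⟹ the few-prime crux on the Frey class.** If the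
product-of-valuations bound with exponent `ε` holds for abc triples with `ω(abc) ≤ 4`, then every
elliptic `W/ℚ` that is `ℚ`-isomorphic to a twisted Frey curve `freyCurve (d a) (d b)` (`a, b`
coprime, `ab(a+b) ≠ 0`, `d ∣ 2`) and has `≤ 3` odd multiplicative primes satisfies
`T(W) ≤ C_ε N^ε` (no semistability hypothesis needed): by the pointwise dictionary `n = |ab(a+b)|`
has `≤ 3` odd primes, so the rearranged abc triple of `(a, b, a+b)` has `ω ≤ 4` and product `n`;
then `T ≤ 12^{ω(N)} ∏ ν_p(n) ≤ C₁⁴ N^{ε/2} · K (2N)^{ε/2}`. `[folklore]` -/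
theorem AbcValuationProduct.fewPrimeFrey_of_fewPrimes
    (h : ∀ ε : ℝ, 0 < ε → ∃ K : ℝ, ∀ a b c : ℕ, IsABCTriple a b c →
      (a * b * c).primeFactors.card ≤ 4 →
      (exponentProduct (a * b * c) : ℝ) ≤ K * (rad a b c : ℝ) ^ ε) :
    ∀ ε : ℝ, 0 < ε → ∃ C : ℝ, ∀ (W : WeierstrassCurve ℚ) [W.IsElliptic],
      (∃ (a b d : ℤ) (C' : VariableChange ℚ), IsCoprime a b ∧ a * b * (a + b) ≠ 0 ∧ d ∣ 2 ∧
        C' • W = freyCurve (d * a) (d * b)) →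
      ((W.conductorNorm ℤ).primeFactors.filter
        (fun p => p ≠ 2 ∧ ¬ p ^ 2 ∣ W.conductorNorm ℤ)).card ≤ 3 →
      ((∏ p ∈ (W.conductorNorm ℤ).primeFactors with ¬ p ^ 2 ∣ W.conductorNorm ℤ,
        (W.minimalDiscriminantNorm ℤ).factorization p : ℕ) : ℝ) ≤
          C * (W.conductorNorm ℤ : ℝ) ^ ε := by
  intro ε hε
  obtain ⟨K, hK⟩ := h (ε / 2) (by positivity)
  obtain ⟨C₁, hC₁, hω⟩ := exists_two_pow_card_primeFactors_le (ε / 8) (by positivity)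
  refine ⟨C₁ ^ 4 * max K 0 * (2 : ℝ) ^ (ε / 2), fun W _ hfrey h3 => ?_⟩
  obtain ⟨a, b, d, C', hab, h0, hd, hW⟩ := hfrey
  obtain ⟨hT, hradn, hmult⟩ := AbcValuationProduct.freyClass_pointwise hab h0 hd hW
  rw [← multiplicativeValuationProduct_def]
  set N : ℕ := W.conductorNorm ℤ with hNdef
  set n : ℕ := (a * b * (a + b)).natAbs with hn
  have hNpos : 0 < N := conductorNorm_pos_holds _
  have hNreal : (0 : ℝ) < (N : ℝ) := by exact_mod_cast hNpos
  -- `ω(n) ≤ 4`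
  have hn4 : n.primeFactors.card ≤ 4 := by
    have h1 := (Finset.card_le_card hmult).trans h3
    have h2 : n.primeFactors.card - 1 ≤ (n.primeFactors.erase 2).card :=
      Finset.pred_card_le_card_erase
    omega
  -- `12^ω(N) ≤ (2^ω(N))⁴ ≤ (C₁ rad(N)^{ε/8})⁴ ≤ C₁⁴ N^{ε/2}`
  have hradN : (∏ p ∈ N.primeFactors, (p : ℝ)) ≤ (N : ℝ) := by
    have h := Nat.le_of_dvd hNpos (Nat.prod_primeFactors_dvd N)
    rw [← Nat.cast_prod]
    exact_mod_cast h
  have h2ω : (2 : ℝ) ^ N.primeFactors.card ≤ C₁ * (N : ℝ) ^ (ε / 8) :=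
    (hω N).trans (mul_le_mul_of_nonneg_left
      (Real.rpow_le_rpow (by positivity) hradN (by positivity)) hC₁.le)
  have h12ω : (12 : ℝ) ^ N.primeFactors.card ≤ C₁ ^ 4 * (N : ℝ) ^ (ε / 2) := by
    calc (12 : ℝ) ^ N.primeFactors.card ≤ (2 ^ 4) ^ N.primeFactors.card :=
          pow_le_pow_left₀ (by norm_num) (by norm_num) _
      _ = ((2 : ℝ) ^ N.primeFactors.card) ^ 4 := by rw [← pow_mul, mul_comm, pow_mul]
      _ ≤ (C₁ * (N : ℝ) ^ (ε / 8)) ^ 4 := pow_le_pow_left₀ (by positivity) h2ω 4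
      _ = C₁ ^ 4 * ((N : ℝ) ^ (ε / 8)) ^ (4 : ℕ) := mul_pow _ _ _
      _ = C₁ ^ 4 * (N : ℝ) ^ (ε / 2) := by
          congr 1
          rw [← Real.rpow_natCast ((N : ℝ) ^ (ε / 8)) 4, ← Real.rpow_mul hNreal.le]
          congr 1
          push_cast
          ring
  -- the milestone on the rearranged triple (`ω ≤ 4`): `∏_{p ∣ n} v_p(n) ≤ max(K,0) (2N)^{ε/2}`
  obtain ⟨x, y, z, hxyz, hprod⟩ := exists_isABCTriple_of_isCoprime hab h0
  have hK' := hK x y z hxyz (by rw [hprod, ← hn]; exact hn4)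
  rw [rad_def, hprod, ← hn] at hK'
  have hradnR : ((radical n : ℕ) : ℝ) ≤ 2 * (N : ℝ) := by exact_mod_cast hradn
  have hP : (exponentProduct n : ℝ) ≤ max K 0 * ((2 : ℝ) ^ (ε / 2) * (N : ℝ) ^ (ε / 2)) := by
    calc (exponentProduct n : ℝ) ≤ K * ((radical n : ℕ) : ℝ) ^ (ε / 2) := hK'
      _ ≤ max K 0 * ((radical n : ℕ) : ℝ) ^ (ε / 2) :=
          mul_le_mul_of_nonneg_right (le_max_left _ _) (by positivity)
      _ ≤ max K 0 * (2 * (N : ℝ)) ^ (ε / 2) :=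
          mul_le_mul_of_nonneg_left (Real.rpow_le_rpow (by positivity) hradnR (by positivity))
            (le_max_right _ _)
      _ = max K 0 * ((2 : ℝ) ^ (ε / 2) * (N : ℝ) ^ (ε / 2)) := by
          rw [Real.mul_rpow (by norm_num) hNreal.le]
  -- assemble
  have hTreal : (multiplicativeValuationProduct W : ℝ) ≤
      (12 : ℝ) ^ N.primeFactors.card * (exponentProduct n : ℝ) := by
    exact_mod_cast hT
  calc (multiplicativeValuationProduct W : ℝ)
      ≤ (12 : ℝ) ^ N.primeFactors.card * (exponentProduct n : ℝ) := hTreal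
    _ ≤ (C₁ ^ 4 * (N : ℝ) ^ (ε / 2)) * (max K 0 * ((2 : ℝ) ^ (ε / 2) * (N : ℝ) ^ (ε / 2))) :=
        mul_le_mul h12ω hP (by positivity) (by positivity)
    _ = C₁ ^ 4 * max K 0 * (2 : ℝ) ^ (ε / 2) * ((N : ℝ) ^ (ε / 2) * (N : ℝ) ^ (ε / 2)) := by
        ring
    _ = C₁ ^ 4 * max K 0 * (2 : ℝ) ^ (ε / 2) * (N : ℝ) ^ ε := by
        rw [← Real.rpow_add hNreal, add_halves]

/-! ### r4F gives the milestone on `ω(abc) ≤ 4` -/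

-- adapted from Summits/ABC/ABC/Theorems/RibetTakahashiSplitAbcValuationProductTwoPrimes.lean
-- (`AbcValuationProduct.fewPrimes_of_fewPrimeValuationProduct`), with the Frey-class witness of
-- `FreyClassSuffices.exists_freyCurve_model` so that only the RESTRICTED crux is applied.
/-- **The few-prime crux on the Frey class ⟹ `[∏ ν_p(abc) ≪_ε rad^ε on ω(abc) ≤ 4]`.** For an abc
triple with `ω(abc) ≤ 4` the curve `W` of `FreyClassSuffices.exists_freyCurve_model` is semistable
away from `2`, lies in the Frey–Hellegouarch class, has `N_W ∣ 2¹⁰ rad(abc)` — so at most `3` odd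
multiplicative primes — and `∏ ν_p(abc) ≤ 4 T(W) ≤ 4 C (2¹⁰ rad)^ε`.
[cite: BombieriGubler2006, Ex. 12.5.10] -/
theorem AbcValuationProduct.fewPrimes_of_fewPrimeFrey
    (h₄ : ∀ ε : ℝ, 0 < ε → ∃ C : ℝ, ∀ (W : WeierstrassCurve ℚ) [W.IsElliptic],
      (∀ p : ℕ, p.Prime → p ≠ 2 → ¬ p ^ 2 ∣ W.conductorNorm ℤ) →
      (∃ (a b d : ℤ) (C' : VariableChange ℚ), IsCoprime a b ∧ a * b * (a + b) ≠ 0 ∧ d ∣ 2 ∧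
        C' • W = freyCurve (d * a) (d * b)) →
      ((W.conductorNorm ℤ).primeFactors.filter
        (fun p => p ≠ 2 ∧ ¬ p ^ 2 ∣ W.conductorNorm ℤ)).card ≤ 3 →
      ((∏ p ∈ (W.conductorNorm ℤ).primeFactors with ¬ p ^ 2 ∣ W.conductorNorm ℤ,
        (W.minimalDiscriminantNorm ℤ).factorization p : ℕ) : ℝ) ≤
          C * (W.conductorNorm ℤ : ℝ) ^ ε) :
    ∀ ε : ℝ, 0 < ε → ∃ K : ℝ, ∀ a b c : ℕ, IsABCTriple a b c →
      (a * b * c).primeFactors.card ≤ 4 →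
      (exponentProduct (a * b * c) : ℝ) ≤ K * (rad a b c : ℝ) ^ ε := by
  intro ε hε
  obtain ⟨C₄, hC₄⟩ := h₄ ε hε
  refine ⟨4 * max C₄ 0 * ((2 : ℝ) ^ 10) ^ ε, fun a b c ht h4 => ?_⟩
  obtain ⟨W, hE, hss, hfrey, hN, -, hprod⟩ := FreyClassSuffices.exists_freyCurve_model ht
  haveI := hE
  have hR : (0 : ℝ) < (rad a b c : ℝ) := cast_rad_pos a b c
  have hrad0 : rad a b c ≠ 0 := by rw [rad_def]; exact (Nat.radical_pos _).ne'
  have h210 : 2 ^ 10 * rad a b c ≠ 0 := mul_ne_zero (by norm_num) hrad0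
  -- the odd multiplicative primes of the Frey curve are odd primes of `abc`: at most `3` of them
  have hsub : (W.conductorNorm ℤ).primeFactors.filter
      (fun p => p ≠ 2 ∧ ¬ p ^ 2 ∣ W.conductorNorm ℤ) ⊆ (a * b * c).primeFactors.erase 2 := by
    intro p hp
    rw [Finset.mem_filter] at hp
    refine Finset.mem_erase.2 ⟨hp.2.1, ?_⟩
    have h1 : p ∈ (2 ^ 10 * rad a b c).primeFactors := Nat.primeFactors_mono hN h210 hp.1
    rw [Nat.primeFactors_mul (by norm_num) hrad0, Nat.primeFactors_prime_pow (by norm_num)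
      Nat.prime_two, rad_def, Nat.primeFactors_radical, Finset.mem_union,
      Finset.mem_singleton] at h1
    exact h1.resolve_left hp.2.1
  have h3 : ((W.conductorNorm ℤ).primeFactors.filter
      (fun p => p ≠ 2 ∧ ¬ p ^ 2 ∣ W.conductorNorm ℤ)).card ≤ 3 := by
    have := Finset.card_le_card hsub
    rw [AbcValuationProduct.card_primeFactors_erase_two ht] at this
    omega
  have hT : (multiplicativeValuationProduct W : ℝ) ≤ max C₄ 0 * (W.conductorNorm ℤ : ℝ) ^ ε :=
    (hC₄ W hss hfrey h3).trans (mul_le_mul_of_nonneg_right (le_max_left _ _) (by positivity))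
  -- `N ≤ 2¹⁰ rad`
  have hNR : (W.conductorNorm ℤ : ℝ) ≤ 2 ^ 10 * (rad a b c : ℝ) := by
    exact_mod_cast Nat.le_of_dvd (Nat.pos_of_ne_zero h210) hN
  calc (exponentProduct (a * b * c) : ℝ) ≤ ((4 * multiplicativeValuationProduct W : ℕ) : ℝ) := by
        rw [exponentProduct_def]; exact_mod_cast hprod
    _ = 4 * (multiplicativeValuationProduct W : ℝ) := by push_cast; ring
    _ ≤ 4 * (max C₄ 0 * (W.conductorNorm ℤ : ℝ) ^ ε) := by linarith
    _ ≤ 4 * (max C₄ 0 * ((2 : ℝ) ^ 10 * (rad a b c : ℝ)) ^ ε) := by gcongr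
    _ = 4 * max C₄ 0 * ((2 : ℝ) ^ 10) ^ ε * (rad a b c : ℝ) ^ ε := by
        rw [Real.mul_rpow (by positivity) hR.le]; ring

/-! ### The equivalences -/

/-- **r4F ⟺ the milestone on `ω(abc) ≤ 4`.** The few-prime crux `FewPrimeValuationProduct`
(stmt-ABC-1563) restricted to the Frey–Hellegouarch class is EQUIVALENT to the product-of-valuations
bound `∏ ν_p(abc) ≤ K_ε rad(abc)^ε` for the abc triples with `ω(abc) ≤ 4` (at most `3` odd prime
factors). In the "⟸" direction the semistability-away-from-`2` hypothesis of the crux is not even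
used. `[folklore]` -/
theorem fewPrimeFrey_iff_fewPrimes :
    (∀ ε : ℝ, 0 < ε → ∃ C : ℝ, ∀ (W : WeierstrassCurve ℚ) [W.IsElliptic],
      (∀ p : ℕ, p.Prime → p ≠ 2 → ¬ p ^ 2 ∣ W.conductorNorm ℤ) →
      (∃ (a b d : ℤ) (C' : VariableChange ℚ), IsCoprime a b ∧ a * b * (a + b) ≠ 0 ∧ d ∣ 2 ∧
        C' • W = freyCurve (d * a) (d * b)) →
      ((W.conductorNorm ℤ).primeFactors.filter
        (fun p => p ≠ 2 ∧ ¬ p ^ 2 ∣ W.conductorNorm ℤ)).card ≤ 3 →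
      ((∏ p ∈ (W.conductorNorm ℤ).primeFactors with ¬ p ^ 2 ∣ W.conductorNorm ℤ,
        (W.minimalDiscriminantNorm ℤ).factorization p : ℕ) : ℝ) ≤
          C * (W.conductorNorm ℤ : ℝ) ^ ε) ↔
    (∀ ε : ℝ, 0 < ε → ∃ K : ℝ, ∀ a b c : ℕ, IsABCTriple a b c →
      (a * b * c).primeFactors.card ≤ 4 →
      (exponentProduct (a * b * c) : ℝ) ≤ K * (rad a b c : ℝ) ^ ε) := by
  refine ⟨AbcValuationProduct.fewPrimes_of_fewPrimeFrey, fun h ε hε => ?_⟩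
  obtain ⟨C, hC⟩ := AbcValuationProduct.fewPrimeFrey_of_fewPrimes h ε hε
  exact ⟨C, fun W _ _ hfrey h3 => hC W hfrey h3⟩

/-- **The milestone on `ω(abc) ≤ 4` ⟺ the milestone on `ω(abc) ∈ {3, 4}`**: the regime `ω(abc) ≤ 2`
is the theorem `AbcValuationProduct.of_card_primeFactors_le_two` (Mihăilescu). `[folklore]` -/
theorem AbcValuationProduct.fewPrimes_iff_threeFour :
    (∀ ε : ℝ, 0 < ε → ∃ K : ℝ, ∀ a b c : ℕ, IsABCTriple a b c →
      (a * b * c).primeFactors.card ≤ 4 →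
      (exponentProduct (a * b * c) : ℝ) ≤ K * (rad a b c : ℝ) ^ ε) ↔
    (∀ ε : ℝ, 0 < ε → ∃ K : ℝ, ∀ a b c : ℕ, IsABCTriple a b c →
      3 ≤ (a * b * c).primeFactors.card → (a * b * c).primeFactors.card ≤ 4 →
      (exponentProduct (a * b * c) : ℝ) ≤ K * (rad a b c : ℝ) ^ ε) := by
  refine ⟨fun h ε hε => ?_, fun h ε hε => ?_⟩
  · obtain ⟨K, hK⟩ := h ε hε
    exact ⟨K, fun a b c ht _ h4 => hK a b c ht h4⟩
  · obtain ⟨K₂, hK₂⟩ := AbcValuationProduct.of_card_primeFactors_le_two ε hε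
    obtain ⟨K₃, hK₃⟩ := h ε hε
    refine ⟨max K₂ K₃, fun a b c ht h4 => ?_⟩
    have hR : (0 : ℝ) < (rad a b c : ℝ) := cast_rad_pos a b c
    rcases le_or_gt 3 (a * b * c).primeFactors.card with h3 | h2
    · exact (hK₃ a b c ht h3 h4).trans
        (mul_le_mul_of_nonneg_right (le_max_right _ _) (Real.rpow_nonneg hR.le _))
    · exact (hK₂ a b c ht (by omega)).trans
        (mul_le_mul_of_nonneg_right (le_max_left _ _) (Real.rpow_nonneg hR.le _))

/-- **r4F ⟺ the milestone on `ω(abc) ∈ {3, 4}`.** The few-prime crux re-cut to the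
Frey–Hellegouarch class is exactly the product-of-valuations bound `∏ ν_p(abc) ≤ K_ε rad(abc)^ε`,
uniform in the primes, for the coprime `S`-unit equations `a + b = c` with `S = {2, p, q}` or
`{2, p, q, r}` (`p^x ± q^y = 2^z`, `p^x q^y ± 1 = 2^z`, `2^z p^x ± q^y = r^w`, …) — equivalently
(`AbcValuationProduct.bddOmega_iff_subexp`, sibling file) sub-exponential abc `log c ≤ κ_ε rad^ε` for
them. `[folklore]` -/
theorem fewPrimeFrey_iff_threeFour :
    (∀ ε : ℝ, 0 < ε → ∃ C : ℝ, ∀ (W : WeierstrassCurve ℚ) [W.IsElliptic],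
      (∀ p : ℕ, p.Prime → p ≠ 2 → ¬ p ^ 2 ∣ W.conductorNorm ℤ) →
      (∃ (a b d : ℤ) (C' : VariableChange ℚ), IsCoprime a b ∧ a * b * (a + b) ≠ 0 ∧ d ∣ 2 ∧
        C' • W = freyCurve (d * a) (d * b)) →
      ((W.conductorNorm ℤ).primeFactors.filter
        (fun p => p ≠ 2 ∧ ¬ p ^ 2 ∣ W.conductorNorm ℤ)).card ≤ 3 →
      ((∏ p ∈ (W.conductorNorm ℤ).primeFactors with ¬ p ^ 2 ∣ W.conductorNorm ℤ,
        (W.minimalDiscriminantNorm ℤ).factorization p : ℕ) : ℝ) ≤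
          C * (W.conductorNorm ℤ : ℝ) ^ ε) ↔
    (∀ ε : ℝ, 0 < ε → ∃ K : ℝ, ∀ a b c : ℕ, IsABCTriple a b c →
      3 ≤ (a * b * c).primeFactors.card → (a * b * c).primeFactors.card ≤ 4 →
      (exponentProduct (a * b * c) : ℝ) ≤ K * (rad a b c : ℝ) ^ ε) :=
  fewPrimeFrey_iff_fewPrimes.trans AbcValuationProduct.fewPrimes_iff_threeFour

end Summit.ABC.ABC.Theorems

end
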